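import Literature.MathematicalPhysics.QuantumFieldTheory.Balaban1983to89.B5G183AliasSum

/-!
# `Balaban1983to89.B5G183CovSplit` — the SIDE-COVARIANT free/regular split of the continued (1.83) entry symbol of `G = Δ₁⁻¹` by the resolvent-expanded MASSIVE free diagonal, with `n`-UNIFORM double alias sum, side covariance and holomorphy of the regular part (cell node X9, successor of `B5G183AliasSum`)

T. Bałaban, *Propagators and renormalization transformations for lattice gauge theories. I*, Commun. Math.
Phys. **95**, 17–40 (1984) [`Balaban1984PropagatorsI`, cell paper B5], (1.83)–(1.84) p. 31 [PDF 15], text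
p. 32–33 [PDF 16–17], and p. 38 [PDF 22] (the «analyticity method» pointer to the proof of Lemma 2.4 of
[`Balaban1983RegularityDecay`], CMP 89).  LOCATIONS only: NOTHING printed in B5 is a hypothesis, a quotation or a
`[cite:]`-tagged statement of this file; every declaration is `[folklore]` algebra/estimates about the tree's own
objects, kernel-checked from the imported tree modules.  No `axiom`, no `sorry`.

## The problem this file solves (located residual G-pv15g10-3 (i) of the cell's GAPS.md)

For the exponential decay of the kernel of `G(1)` by the lineage's contour-shift route (`B4ContourShift` →
`B4Green244` → `B5Hk163Decay` for (1.63)) one needs a split `g = FREE + REG` of the continued (1.83) entry symbol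
`g183 n μ ν l l′ p′` (`B5G183Strip`) in which `FREE` is an explicitly known free fine-lattice object and `REG` is
(a) holomorphic on the zero-free strip, (b) bounded there in the double alias ℓ¹-sum UNIFORMLY IN `n`, and
(c) SIDE-COVARIANT, `REG(l,l′; p′+2πe_i) = REG(σ_i l, σ_i l′; p′)`, so that its fine-offset multiplier is
`2π`-periodic in `Re p′_i` (the side condition of a `StripRegular` instance).  `B5G183AliasSum` achieved (a)+(b) with
`FREE = δ_{μν}δ_{ll′}[l ≠ 0]/Δ(p′+l)` but NOT (c): the residue re-indexing `σ_i` moves `l = 0`.  Subtracting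
`1/Δ(p′+l)` for all `l` is impossible (`Δ(p′) = 0` at `p′ = 0`); subtracting the massive `1/(Δ(p′+l)+1)` for all `l`
is covariant and regular but leaves the diagonal remainder `1/(Δ(Δ+1))`, whose alias sum `Σ_l W_n(l)^{−2}`
diverges logarithmically at `d = 4`.  THE FIX typed here: subtract the RESOLVENT EXPANSION
`R_N(Δ(p′+l)) = Σ_{j<N}(Δ(p′+l)+1)^{−(j+1)}` — a polynomial in the massive free propagator, regular at `Δ = 0`,
a function of `p′+l` only (hence covariant for ALL `l`) — whose remainder `1/Δ − R_N(Δ) = 1/(Δ(Δ+1)^N)`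
(`inv_sub_resolv`) decays like `W_n(l)^{−(N+1)}`, summable uniformly in `n` as soon as `N + 1 ≥ d`.

## What is certified here (kernel; 0 sorry; std axioms)

For every `n ≥ 1` (`[NeZero n]`), `0 ≤ κ ≤ κ₁₈₃(d)` (`B5G183Strip.kappa183`), `p′ ∈ Strip d κ`, all `μ ν l l′`,
every `N : ℕ`:
* §1 `resolv N z := Σ_{j<N} 1/(z+1)^{j+1}`; **`inv_sub_resolv`: `1/z − R_N(z) = 1/(z(z+1)^N)`** (`z ≠ 0`,
  `z+1 ≠ 0`); `norm_resolv_le`: `‖R_N(z)‖ ≤ N/c^N` if `0 < c ≤ 1`, `c ≤ ‖z+1‖`.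
* §2 on the fat strip `F_r`, `r ≤ 1/4`, `d r² ≤ 1/16` (hence on `Strip d κ`): `re_DeltaXi0_ge`: `Re Δ^ξ(q) ≥ −25/64`
  (from `B4StripCauchy.re_Sxi_ge`), so `norm_DeltaXi0_add_one_ge`: `‖Δ^ξ(q)+1‖ ≥ 39/64` — the massive point is
  never reached, the origin `q = 0` included; `norm_DeltaXi_shift_add_one_ge`: `‖Δ^ξ(q+2πl)+1‖ ≥ 1 + (7/64)W_n(l)`
  (`l ≠ 0`, from `B4StripSums.re_DeltaXi_shift_ge_W`); `norm_remainder_shift_le`: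
  `‖1/(Δ(q+2πl)(Δ(q+2πl)+1)^N)‖ ≤ (64/7)^{N+1} W_n(l)^{−(N+1)}`.
* §3 `freeN N μ ν l l′ p′ := δ_{μν}δ_{ll′} R_N(Δ(p′+l))`, **`g183cov N := g183 − freeN N`**; `g183cov_eq`:
  `g^{cov,N} = g^{reg} + (freeDiag − freeN)` (a diagonal correction of `B5G183AliasSum.g183reg`);
  **`freeN_tr`** (unconditional) and **`g183cov_tr`**: at a side point `Re p′_i = −π` of the strip,
  `g^{cov,N}(l,l′; p′+2πe_i) = g^{cov,N}(σ_i l, σ_i l′; p′)` (from `B5G183Alias.g183_tr`, `DeltaXi_shift_tr`,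
  injectivity of `σ_i`); `sum_norm_g183cov_tr`: the double alias sum of `‖g^{cov,N}‖` takes the same value at `p′`
  and `p′ + 2πe_i`.
* §4 `inv_W_pow_le_prod`: `W_n(l)^{−M} ≤ Π_ν ω_n(l_ν)^{−2}` (`l ≠ 0`, `M ≥ d`); `sum_prod_inv_sq_le`:
  `Σ_l Π_ν ω_n(l_ν)^{−2} ≤ (2ζ₂)^d`; `norm_freeDiag_sub_freeN_le`: `‖freeDiag − freeN‖ ≤ δ_{ll′} cw_N(l)` with
  `cw_N(0) = N(64/39)^N`, `cw_N(l) = (64/7)^{N+1}W_n(l)^{−(N+1)}`; `sum_cw_le` (`N+1 ≥ d`): `Σ_l cw_N(l) ≤ Mcorr d N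
  := N(64/39)^N + (64/7)^{N+1}(2ζ₂)^d`; **`sum_norm_g183cov_le`: for `N + 1 ≥ d`,
  `Σ_{l,l′} ‖g_{μν}(l,l′;p′) − δ_{μν}δ_{ll′}R_N(Δ(p′+l))‖ ≤ Mcov183 d N := Mreg183 d + Mcorr d N`** — UNIFORM IN
  `n`, in `p′` on the strip, in `μ, ν`; `norm_freeN_le` (`≤ N(64/39)^N` entrywise) and `norm_g183cov_le`
  (`≤ M183 d + N(64/39)^N` entrywise, uniform in `n, l, l′`).
* §5 `DeltaXi_shift_add_one_ne_zero` (all `l`); `differentiableAt_freeN`, **`differentiableAt_g183cov`**: the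
  covariant regular part is (jointly) holomorphic at every point of the zero-free strip.

Together: `REG := g183cov N` with `N = d − 1` (any `N ≥ d − 1`) satisfies (a), (b), (c) above, and
`FREE = δ_{μν}δ_{ll′}Σ_{j<N}(Δ(p′+l)+1)^{−(j+1)}` is the alias-diagonal symbol of the explicit fine-lattice operator
`δ_{μν}Σ_{j<N}(−Δ^η+1)^{−(j+1)}` — powers of the unit-mass free propagator on the `η`-lattice, whose kernels and
their exponential decay are classical and independent of everything in B5.

## Dictionary (paper ↦ tree ↦ here)

`Δ(p′+l) ↦ DeltaXi n 0 (shift n k p)`; `σ_i ↦ B5Strip145Analytic.sigma n i` (`sigmaEquiv`), `p′+2πe_i ↦ tr p i`;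
`g_{μν}(l,l′;p′) ↦ B5G183Strip.g183 n μ ν k k' p`; `g^{reg}`, `freeDiag`, `Mreg183` (`B5G183AliasSum`);
`ω_n, W_n, ζ₂ = zetaC 2` (`B4StripSums`).  New here: `resolv`, `freeN`, `g183cov`, `cw`, `Mcorr`, `Mcov183`.

## HONEST SCOPE

(i) No `B4ContourShift.StripRegular` instance is assembled here: the remaining steps — the fine-offset phases
`e^{i(p′+2πl)a/n}`, `e^{−i(p′+2πl′)b/n}` (unimodular up to `e^{2κ}` on the strip, cf. `B5Hk163Decay`), the
multiplier `m^{cov}_{ab}(p′) := Σ_{l,l′} e^{…} g^{cov,N}(l,l′;p′) e^{…}`, its holomorphy in each coordinate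
(finite sum of `differentiableAt_g183cov`), its sup bound (`e^{2κ}·Mcov183`-type from `sum_norm_g183cov_le`) and its
side periodicity (from `g183cov_tr` + `Equiv.sum_comp (sigmaEquiv n i)` + the `2π`-periodicity of the phases in
`Re p′_i`, exactly as `B5Hk163Decay.stripRegular_G163` does for (1.63)) — are the consumer's bookkeeping over its own
index conventions (t4-ne2-p2, GAPS G-ne2p2-9 (β)); every analytic input they need about `g^{cov,N}` is above.
(ii) The FREE part is left as a symbol; its kernel (a polynomial of degree `N`, any fixed `N ≥ d−1`, in the
massive free `η`-lattice propagator) and that kernel's decay are NOT typed here (classical; not a B5 statement).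
(iii) CONSTANTS are crude (`Mcov183 d N` inherits the towers of `B5G183AliasSum`; `(64/39)^N`, `(64/7)^{N+1}`);
only independence of `n`, `p′`, `l`, `l′` is content.  (iv) `U = 1`, `a = 1`, `n ≥ 1`, as in the whole b05/pv15
lineage.  (v) Nothing here is a claim about the printed text: B5 proves Proposition 1.2 by a different grouping
(the operator identity (1.88) and the «analyticity method» applied to `𝒟(p′)⁻¹`); the resolvent-expanded split is
this lineage's device for making the aliased fiber sums `n`-uniform, recorded as such.  (vi) Float cross-check
(cell archive `b2b-balaban-pv15-g10/num4/check183cov.py|.out`, direct transcription of the regrouped formulas):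
the resolvent identity to `1e−13`; `d = 3`, `N = 2`, side point `Re p′₀ = −π`, `n = 2,…,6`: covariant double sum
`3.45 → 6.05` (`μ = ν = 0`), `0.26 → 0.41` (`μ = ν = 1`), saturating, while the full sum grows linearly in `n`;
covariance defect `max |g^{cov}(l,l′;p′+2πe₀) − g^{cov}(σ₀l,σ₀l′;p′)| ≤ 1.3e−15`; near `p′ = 0`: `0.99`
(`n = 2,…,5`); `d = 2`, `N = 1`, `n = 2,…,12`: `3.64 → 5.80`.  Value = kernel
certificate (inputs (a)–(c) for the (1.83) decay layer of cell GAPS row G-ne2p2-9 (β), X9), NOT summit progress.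
Unit `b2b-balaban-pv15-g10` (PV15 cell lineage, generation 10; author of `B5G183Strip`, `B5G183Alias`,
`B5G183AliasSum`).
-/

open scoped BigOperators ComplexConjugate Real
open Finset Complex

namespace Literature.MathematicalPhysics.QuantumFieldTheory.Balaban1983to89.B5G183CovSplit

open Literature.MathematicalPhysics.QuantumFieldTheory.Balaban1983to89.B4Strip
open Literature.MathematicalPhysics.QuantumFieldTheory.Balaban1983to89.B4StripCauchy
open Literature.MathematicalPhysics.QuantumFieldTheory.Balaban1983to89.B5Symbol166
open Literature.MathematicalPhysics.QuantumFieldTheory.Balaban1983to89.B5Strip145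
open Literature.MathematicalPhysics.QuantumFieldTheory.Balaban1983to89.B5Strip145Analytic
open Literature.MathematicalPhysics.QuantumFieldTheory.Balaban1983to89.B5Symbol166Strip hiding Afac
open Literature.MathematicalPhysics.QuantumFieldTheory.Balaban1983to89.B5Hk163Strip hiding Afac
open Literature.MathematicalPhysics.QuantumFieldTheory.Balaban1983to89.B5Hk163Alias
open Literature.MathematicalPhysics.QuantumFieldTheory.Balaban1983to89.B5G183Strip
open Literature.MathematicalPhysics.QuantumFieldTheory.Balaban1983to89.B5G183Alias
open Literature.MathematicalPhysics.QuantumFieldTheory.Balaban1983to89.B5G183AliasSum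
open Literature.MathematicalPhysics.QuantumFieldTheory.Balaban1983to89.B4StripSums (W omega zetaC one_le_W
  omega_sq_le_W omega_pos omega_zero one_le_omega W_nonneg re_DeltaXi_shift_ge_W zetaC_nonneg)

variable {d : ℕ}

/-! ## §1. The resolvent expansion `R_N(z) = Σ_{j<N} (z+1)^{-(j+1)}` of `1/z` around the massive point -/

section Resolv

/-- `R_N(z) := Σ_{j<N} 1/(z+1)^{j+1}` — the first `N` terms of the resolvent (Neumann) expansion of `1/z` in powers
of `1/(z+1)`: `1/z = Σ_{j≥0}(z+1)^{−(j+1)}` for `|z+1| > 1`.  Applied to `z = Δ(p′+l)` it is a polynomial in the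
MASSIVE free fine-lattice propagator `(Δ+1)⁻¹`, regular at `Δ = 0`. [folklore] -/
noncomputable def resolv (N : ℕ) (z : ℂ) : ℂ := ∑ j ∈ Finset.range N, 1 / (z + 1) ^ (j + 1)

/-- `R_0 = 0`. [folklore] -/
theorem resolv_zero (z : ℂ) : resolv 0 z = 0 := by simp [resolv]

/-- `R_{N+1}(z) = R_N(z) + (z+1)^{−(N+1)}`. [folklore] -/
theorem resolv_succ (N : ℕ) (z : ℂ) : resolv (N + 1) z = resolv N z + 1 / (z + 1) ^ (N + 1) := by
  unfold resolv; rw [Finset.sum_range_succ]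

/-- **THE RESOLVENT IDENTITY**: `1/z − R_N(z) = 1/(z(z+1)^N)` for `z ≠ 0`, `z + 1 ≠ 0`. [folklore] -/
theorem inv_sub_resolv {z : ℂ} (hz : z ≠ 0) (hz1 : z + 1 ≠ 0) (N : ℕ) :
    1 / z - resolv N z = 1 / (z * (z + 1) ^ N) := by
  induction N with
  | zero => simp [resolv]
  | succ N ih =>
    rw [resolv_succ, ← sub_sub, ih]
    have hp : (z + 1) ^ N ≠ 0 := pow_ne_zero _ hz1
    have hp1 : (z + 1) ^ (N + 1) ≠ 0 := pow_ne_zero _ hz1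
    field_simp
    ring

/-- `‖R_N(z)‖ ≤ N/c^N` whenever `0 < c ≤ 1` and `c ≤ |z+1|`. [folklore] -/
theorem norm_resolv_le {z : ℂ} {c : ℝ} (hc : 0 < c) (hc1 : c ≤ 1) (h : c ≤ ‖z + 1‖) (N : ℕ) :
    ‖resolv N z‖ ≤ N / c ^ N := by
  unfold resolv
  calc ‖∑ j ∈ Finset.range N, 1 / (z + 1) ^ (j + 1)‖
      ≤ ∑ j ∈ Finset.range N, ‖1 / (z + 1) ^ (j + 1)‖ := norm_sum_le _ _
    _ ≤ ∑ j ∈ Finset.range N, 1 / c ^ N := by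
        refine Finset.sum_le_sum (fun j hj => ?_)
        have hjN : j + 1 ≤ N := Finset.mem_range.mp hj
        rw [norm_div, norm_one, norm_pow]
        calc 1 / ‖z + 1‖ ^ (j + 1) ≤ 1 / c ^ (j + 1) :=
              one_div_le_one_div_of_le (pow_pos hc _) (pow_le_pow_left₀ hc.le h _)
          _ ≤ 1 / c ^ N := one_div_le_one_div_of_le (pow_pos hc N) (pow_le_pow_of_le_one hc.le hc1 hjN)
    _ = N / c ^ N := by
        rw [Finset.sum_const, Finset.card_range, nsmul_eq_mul]; ring

end Resolv

/-! ## §2. Real parts of the fine-lattice Laplacian symbol on the fat strip: the massive point `Δ = −1` is far -/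

section RealParts

variable (n : ℕ) [NeZero n]

/-- on the fat strip `F_r` (`r ≤ 1/4`, `d r² ≤ 1/16`): `Re Δ^ξ(q) ≥ −25/64` — the UNSHIFTED symbol may vanish
(at `q = 0`) but stays far from the massive point `−1`. [folklore] -/
theorem re_DeltaXi0_ge {r : ℝ} (hr : r ≤ 1 / 4) (hdr : (d : ℝ) * r ^ 2 ≤ 1 / 16) {q : Fin d → ℂ}
    (hq : q ∈ Fat d r) : -(25 / 64 : ℝ) ≤ (DeltaXi n 0 q).re := by
  have hn : 1 ≤ n := Nat.one_le_iff_ne_zero.mpr (NeZero.ne n)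
  have hre : (DeltaXi n 0 q).re = ∑ ν, (Sxi n (q ν)).re := by
    simp only [DeltaXi, Complex.ofReal_zero, add_zero, Complex.re_sum]
  rw [hre]
  have hlow : ∀ ν, -(25 / 16) * (2 * r) ^ 2 ≤ (Sxi n (q ν)).re := by
    intro ν
    have hy : |(q ν).im| ≤ 2 * r := (hq ν).2
    have hy1 : |(q ν).im| ≤ 1 := hy.trans (by linarith)
    have base := re_Sxi_ge n hn (q ν) hy1
    have hsq : (q ν).im ^ 2 ≤ (2 * r) ^ 2 := by
      have h1 := (abs_le.mp hy).1
      have h2 := (abs_le.mp hy).2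
      nlinarith
    nlinarith [sq_nonneg (Real.sin ((q ν).re / (2 * n))), sq_nonneg (n : ℝ)]
  calc -(25 / 64 : ℝ) ≤ ∑ _ν : Fin d, (-(25 / 16) * (2 * r) ^ 2) := by
        rw [Finset.sum_const, Finset.card_univ, Fintype.card_fin, nsmul_eq_mul]
        have : (d : ℝ) * (-(25 / 16) * (2 * r) ^ 2) = -(25 / 4) * ((d : ℝ) * r ^ 2) := by ring
        rw [this]; linarith
    _ ≤ ∑ ν, (Sxi n (q ν)).re := Finset.sum_le_sum (fun ν _ => hlow ν)

/-- hence `‖Δ^ξ(q) + 1‖ ≥ 39/64` on the fat strip: the massive free propagator `(Δ+1)⁻¹` and its powers are regular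
at every `p′` of the strip, the origin included. [folklore] -/
theorem norm_DeltaXi0_add_one_ge {r : ℝ} (hr : r ≤ 1 / 4) (hdr : (d : ℝ) * r ^ 2 ≤ 1 / 16)
    {q : Fin d → ℂ} (hq : q ∈ Fat d r) : (39 / 64 : ℝ) ≤ ‖DeltaXi n 0 q + 1‖ := by
  have h := re_DeltaXi0_ge n hr hdr hq
  have hre : (DeltaXi n 0 q + 1).re = (DeltaXi n 0 q).re + 1 := by simp
  exact le_trans (by rw [hre]; linarith) (Complex.re_le_norm _)

/-- for `l ≠ 0`: `‖Δ^ξ(q+2πl) + 1‖ ≥ 1 + (7/64)W_n(l)` (the quadratic gain of the shifted symbol survives the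
massive shift). [folklore] -/
theorem norm_DeltaXi_shift_add_one_ge {r : ℝ} (hr : r ≤ 1 / 4) (hdr : (d : ℝ) * r ^ 2 ≤ 1 / 16)
    {q : Fin d → ℂ} (hq : q ∈ Fat d r) (k : Fin d → Fin n) (hk : k ≠ fun _ => 0) :
    1 + 7 / 64 * W n k ≤ ‖DeltaXi n 0 (shift n k q) + 1‖ := by
  have h := re_DeltaXi_shift_ge_W n 0 le_rfl hr hdr hq k hk
  have hre : (DeltaXi n 0 (shift n k q) + 1).re = (DeltaXi n 0 (shift n k q)).re + 1 := by simp
  exact le_trans (by rw [hre]; linarith) (Complex.re_le_norm _)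

/-- the pointwise size of the resolvent REMAINDER at a shifted point: for `l ≠ 0`,
`‖1/(Δ(q+2πl)(Δ(q+2πl)+1)^N)‖ ≤ (64/7)^{N+1}/W_n(l)^{N+1}`. [folklore] -/
theorem norm_remainder_shift_le {r : ℝ} (hr : r ≤ 1 / 4) (hdr : (d : ℝ) * r ^ 2 ≤ 1 / 16)
    {q : Fin d → ℂ} (hq : q ∈ Fat d r) (k : Fin d → Fin n) (hk : k ≠ fun _ => 0) (N : ℕ) :
    ‖1 / (DeltaXi n 0 (shift n k q) * (DeltaXi n 0 (shift n k q) + 1) ^ N)‖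
      ≤ (64 / 7) ^ (N + 1) / W n k ^ (N + 1) := by
  have hW1 := one_le_W n k hk
  have hW : 0 < 7 / 64 * W n k := by positivity
  have h1 : 7 / 64 * W n k ≤ ‖DeltaXi n 0 (shift n k q)‖ := W_le_norm_DeltaXi_shift n hr hdr hq k hk
  have h2 : 7 / 64 * W n k ≤ ‖DeltaXi n 0 (shift n k q) + 1‖ :=
    le_trans (by linarith) (norm_DeltaXi_shift_add_one_ge n hr hdr hq k hk)
  rw [norm_div, norm_one, norm_mul, norm_pow]
  have hprod : (7 / 64 * W n k) ^ (N + 1)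
      ≤ ‖DeltaXi n 0 (shift n k q)‖ * ‖DeltaXi n 0 (shift n k q) + 1‖ ^ N := by
    rw [pow_succ']
    exact mul_le_mul h1 (pow_le_pow_left₀ hW.le h2 N) (pow_nonneg hW.le N) (norm_nonneg _)
  calc 1 / (‖DeltaXi n 0 (shift n k q)‖ * ‖DeltaXi n 0 (shift n k q) + 1‖ ^ N)
      ≤ 1 / (7 / 64 * W n k) ^ (N + 1) := one_div_le_one_div_of_le (pow_pos hW _) hprod
    _ = (64 / 7) ^ (N + 1) / W n k ^ (N + 1) := by
        rw [mul_pow]; field_simp; rw [← mul_pow]; norm_num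

end RealParts

/-! ## §3. The COVARIANT free/regular split `g = freeN + g^{cov}` and its side covariance -/

section Split

variable (n : ℕ) [NeZero n]

/-- the RESOLVENT-EXPANDED MASSIVE FREE DIAGONAL `δ_{μν}δ_{ll′}·R_N(Δ(p′+l))`, for ALL alias offsets `l`
(`l = 0` included — `R_N(Δ(p′))` is regular at `Δ(p′) = 0`). [folklore] -/
noncomputable def freeN (N : ℕ) (μ ν : Fin d) (k k' : Fin d → Fin n) (p : Fin d → ℂ) : ℂ :=
  if μ = ν ∧ k = k' then resolv N (DeltaXi n 0 (shift n k p)) else 0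

/-- **THE COVARIANT REGULAR PART** of the continued (1.83) entry symbol:
`g^{cov,N}_{μν}(l,l′;p′) := g_{μν}(l,l′;p′) − δ_{μν}δ_{ll′}R_N(Δ(p′+l))`. [folklore] -/
noncomputable def g183cov (N : ℕ) (μ ν : Fin d) (k k' : Fin d → Fin n) (p : Fin d → ℂ) : ℂ :=
  g183 n μ ν k k' p - freeN n N μ ν k k' p

/-- `g = freeN + g^{cov,N}` (definition). [folklore] -/
theorem g183_eq_freeN_add_cov (N : ℕ) (μ ν : Fin d) (k k' : Fin d → Fin n) (p : Fin d → ℂ) :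
    g183 n μ ν k k' p = freeN n N μ ν k k' p + g183cov n N μ ν k k' p := by
  unfold g183cov; ring

/-- `g^{cov,N} = g^{reg} + (freeDiag − freeN)`: the covariant regular part differs from the regular part of
`B5G183AliasSum` by a DIAGONAL correction only. [folklore] -/
theorem g183cov_eq (N : ℕ) (μ ν : Fin d) (k k' : Fin d → Fin n) (p : Fin d → ℂ) :
    g183cov n N μ ν k k' p = g183reg n μ ν k k' p + (freeDiag n μ ν k k' p - freeN n N μ ν k k' p) := by
  unfold g183cov g183reg; ring

/-- the diagonal correction, explicitly. [folklore] -/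
theorem freeDiag_sub_freeN (N : ℕ) (μ ν : Fin d) (k k' : Fin d → Fin n) (p : Fin d → ℂ) :
    freeDiag n μ ν k k' p - freeN n N μ ν k k' p =
      if μ = ν ∧ k = k' then
        ((if k ≠ (fun _ => 0) then 1 / DeltaXi n 0 (shift n k p) else 0) - resolv N (DeltaXi n 0 (shift n k p)))
      else 0 := by
  unfold freeDiag freeN
  by_cases hμν : μ = ν
  · by_cases he : k = k'
    · have hc : μ = ν ∧ k = k' := ⟨hμν, he⟩
      rw [if_pos he, if_pos hc, if_pos hc]
      by_cases hk : k = fun _ => 0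
      · have hc' : ¬ (μ = ν ∧ k ≠ fun _ => 0) := fun h => h.2 hk
        have hk' : ¬ (k ≠ fun _ => 0) := fun h => h hk
        rw [if_neg hc', if_neg hk']
      · have hc' : μ = ν ∧ k ≠ (fun _ => 0) := ⟨hμν, hk⟩
        rw [if_pos hc', if_pos hk]
    · have hc : ¬ (μ = ν ∧ k = k') := fun h => he h.2
      rw [if_neg he, if_neg hc, if_neg hc]; ring
  · have hc : ¬ (μ = ν ∧ k = k') := fun h => hμν h.1
    rw [if_neg hc, if_neg hc]
    by_cases he : k = k'
    · have hc' : ¬ (μ = ν ∧ k ≠ fun _ => 0) := fun h => hμν h.1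
      rw [if_pos he, if_neg hc']; ring
    · rw [if_neg he]; ring

/-- **SIDE COVARIANCE OF THE MASSIVE FREE DIAGONAL** (no side condition, no `l ≠ 0` restriction — this is the
point of subtracting `R_N(Δ(p′+l))` for ALL `l`): `freeN(l,l′; p′+2πe_i) = freeN(σ_i l, σ_i l′; p′)`. [folklore] -/
theorem freeN_tr (N : ℕ) (p : Fin d → ℂ) (i μ ν : Fin d) (k k' : Fin d → Fin n) :
    freeN n N μ ν k k' (tr p i) = freeN n N μ ν (sigma n i k) (sigma n i k') p := by
  unfold freeN
  rw [DeltaXi_shift_tr]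
  by_cases he : k = k'
  · subst he; simp
  · have hne : sigma n i k ≠ sigma n i k' := fun h => he ((sigmaEquiv n i).injective h)
    rw [if_neg (fun h => he h.2), if_neg (fun h => hne h.2)]

/-- **SIDE COVARIANCE OF THE COVARIANT REGULAR PART**: on the zero-free strip, at a side point `Re p′_i = −π`,
`g^{cov,N}(l,l′; p′+2πe_i) = g^{cov,N}(σ_i l, σ_i l′; p′)` — from `B5G183Alias.g183_tr` and `freeN_tr`. [folklore] -/
theorem g183cov_tr {κ : ℝ} (hκ0 : 0 ≤ κ) (hκ : κ ≤ kappa183 d) {p : Fin d → ℂ} (hp : p ∈ Strip d κ) (i : Fin d)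
    (hre : (p i).re = -Real.pi) (N : ℕ) (μ ν : Fin d) (k k' : Fin d → Fin n) :
    g183cov n N μ ν k k' (tr p i) = g183cov n N μ ν (sigma n i k) (sigma n i k') p := by
  unfold g183cov
  rw [g183_tr n hκ0 hκ hp i hre μ ν k k', freeN_tr]

/-- alias re-indexing leaves the double alias sum of `g^{cov,N}` unchanged (`σ_i` is a bijection). [folklore] -/
theorem sum_norm_g183cov_sigma (N : ℕ) (p : Fin d → ℂ) (i μ ν : Fin d) :
    ∑ k : Fin d → Fin n, ∑ k' : Fin d → Fin n, ‖g183cov n N μ ν (sigma n i k) (sigma n i k') p‖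
      = ∑ k : Fin d → Fin n, ∑ k' : Fin d → Fin n, ‖g183cov n N μ ν k k' p‖ := by
  have h1 : ∑ k : Fin d → Fin n, ∑ k' : Fin d → Fin n, ‖g183cov n N μ ν (sigma n i k) (sigma n i k') p‖
      = ∑ k : Fin d → Fin n, ∑ k' : Fin d → Fin n, ‖g183cov n N μ ν k (sigma n i k') p‖ :=
    Equiv.sum_comp (sigmaEquiv n i) (fun k => ∑ k' : Fin d → Fin n, ‖g183cov n N μ ν k (sigma n i k') p‖)
  rw [h1]
  exact Finset.sum_congr rfl (fun k _ =>
    Equiv.sum_comp (sigmaEquiv n i) (fun k' => ‖g183cov n N μ ν k k' p‖))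

/-- hence, at a side point of the zero-free strip, **the double alias sum of `g^{cov,N}` is `2π`-PERIODIC in
`Re p′_i`**: `Σ_{l,l′}‖g^{cov,N}(l,l′;p′+2πe_i)‖ = Σ_{l,l′}‖g^{cov,N}(l,l′;p′)‖`. [folklore] -/
theorem sum_norm_g183cov_tr {κ : ℝ} (hκ0 : 0 ≤ κ) (hκ : κ ≤ kappa183 d) {p : Fin d → ℂ} (hp : p ∈ Strip d κ)
    (i : Fin d) (hre : (p i).re = -Real.pi) (N : ℕ) (μ ν : Fin d) :
    ∑ k : Fin d → Fin n, ∑ k' : Fin d → Fin n, ‖g183cov n N μ ν k k' (tr p i)‖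
      = ∑ k : Fin d → Fin n, ∑ k' : Fin d → Fin n, ‖g183cov n N μ ν k k' p‖ := by
  simp_rw [g183cov_tr n hκ0 hκ hp i hre]
  exact sum_norm_g183cov_sigma n N p i μ ν

end Split

/-! ## §4. The `n`-uniform double alias sum of the covariant regular part -/

section Sums

variable (n : ℕ) [NeZero n]

/-- for `l ≠ 0` and `M ≥ d`: `W_n(l)^{−M} ≤ Π_ν ω_n(l_ν)^{−2}` (`W ≥ ω_ν²` in every coordinate, `W ≥ 1`). [folklore] -/
theorem inv_W_pow_le_prod (k : Fin d → Fin n) (hk : k ≠ fun _ => 0) {M : ℕ} (hM : d ≤ M) :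
    1 / W n k ^ M ≤ ∏ ν, (omega n (k ν) ^ 2)⁻¹ := by
  have hW1 := one_le_W n k hk
  have hW0 : 0 < W n k := by linarith
  have hpos : 0 < ∏ ν, omega n (k ν) ^ 2 :=
    Finset.prod_pos (fun ν _ => pow_pos (omega_pos n _ (k ν).isLt) 2)
  have hWd : ∏ ν, omega n (k ν) ^ 2 ≤ W n k ^ d := by
    calc ∏ ν, omega n (k ν) ^ 2 ≤ ∏ _ν : Fin d, W n k :=
          Finset.prod_le_prod (fun ν _ => (pow_pos (omega_pos n _ (k ν).isLt) 2).le)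
            (fun ν _ => omega_sq_le_W n k hk ν)
      _ = W n k ^ d := by rw [Finset.prod_const, Finset.card_univ, Fintype.card_fin]
  calc 1 / W n k ^ M ≤ 1 / W n k ^ d := one_div_le_one_div_of_le (pow_pos hW0 d) (pow_le_pow_right₀ hW1 hM)
    _ ≤ 1 / ∏ ν, omega n (k ν) ^ 2 := one_div_le_one_div_of_le hpos hWd
    _ = ∏ ν, (omega n (k ν) ^ 2)⁻¹ := by rw [one_div, Finset.prod_inv_distrib]

omit [NeZero n] in
/-- `Σ_l Π_ν ω_n(l_ν)^{−2} ≤ (2ζ₂)^d`, uniformly in `n`. [folklore] -/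
theorem sum_prod_inv_sq_le : ∑ k : Fin d → Fin n, ∏ ν, (omega n (k ν) ^ 2)⁻¹ ≤ (2 * zetaC 2) ^ d := by
  have h := Finset.prod_univ_sum (fun _ : Fin d => (Finset.univ : Finset (Fin n)))
    (fun _ j => (omega n (j : ℕ) ^ 2)⁻¹)
  rw [Fintype.piFinset_univ] at h
  rw [← h]
  have hS : ∑ j : Fin n, (omega n (j : ℕ) ^ 2)⁻¹ ≤ 2 * zetaC 2 := sum_inv_sq_le n
  have hS0 : 0 ≤ ∑ j : Fin n, (omega n (j : ℕ) ^ 2)⁻¹ :=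
    Finset.sum_nonneg (fun j _ => inv_nonneg.mpr (sq_nonneg _))
  calc ∏ _ν : Fin d, ∑ j : Fin n, (omega n (j : ℕ) ^ 2)⁻¹
      ≤ ∏ _ν : Fin d, (2 * zetaC 2) := Finset.prod_le_prod (fun _ _ => hS0) (fun _ _ => hS)
    _ = (2 * zetaC 2) ^ d := by simp

/-- the diagonal correction weight: `N(64/39)^N` at `l = 0`, `(64/7)^{N+1}W_n(l)^{−(N+1)}` at `l ≠ 0`. [folklore] -/
noncomputable def cw (N : ℕ) (k : Fin d → Fin n) : ℝ :=
  if k = fun _ => 0 then (N : ℝ) / (39 / 64) ^ N else (64 / 7) ^ (N + 1) / W n k ^ (N + 1)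

/-- `0 ≤ cw`. [folklore] -/
theorem cw_nonneg (N : ℕ) (k : Fin d → Fin n) : 0 ≤ cw n N k := by
  unfold cw; split_ifs with hk
  · positivity
  · have := one_le_W n k hk; positivity

/-- pointwise bound of the diagonal correction on the zero-free strip: `‖freeDiag − freeN‖ ≤ δ_{ll′}·cw_N(l)`
(`l ≠ 0`: the resolvent identity + `norm_remainder_shift_le`; `l = 0`: `‖R_N(Δ(p′))‖ ≤ N(64/39)^N`). [folklore] -/
theorem norm_freeDiag_sub_freeN_le {κ : ℝ} (hκ0 : 0 ≤ κ) (hκ : κ ≤ kappa183 d) {p : Fin d → ℂ}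
    (hp : p ∈ Strip d κ) (N : ℕ) (μ ν : Fin d) (k k' : Fin d → Fin n) :
    ‖freeDiag n μ ν k k' p - freeN n N μ ν k k' p‖ ≤ if k = k' then cw n N k else 0 := by
  have hr := rOf_le d
  have hdr := d_mul_rOf_sq_le d
  have hq : p ∈ Fat d (rOf d) := strip_subset_fat (rOf_pos d).le (hκ.trans (kappa183_le_rOf d)) hp
  obtain ⟨-, -, -, hD⟩ := denominators_lower n hκ0 hκ hp
  rw [freeDiag_sub_freeN]
  by_cases he : k = k'
  · rw [if_pos he]
    by_cases hμν : μ = ν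
    · rw [if_pos ⟨hμν, he⟩]
      unfold cw
      by_cases hk : k = fun _ => 0
      · rw [if_neg (fun h => h hk), if_pos hk, zero_sub, norm_neg]
        have h39 : (39 / 64 : ℝ) ≤ ‖DeltaXi n 0 (shift n k p) + 1‖ := by
          rw [hk, shift_zero]; exact norm_DeltaXi0_add_one_ge n hr hdr hq
        exact norm_resolv_le (by norm_num) (by norm_num) h39 N
      · rw [if_pos hk, if_neg hk]
        have hz : DeltaXi n 0 (shift n k p) ≠ 0 := by
          intro h0; have := hD k hk; rw [h0, norm_zero] at this; linarith
        have hz1 : DeltaXi n 0 (shift n k p) + 1 ≠ 0 := by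
          intro h0
          have := norm_DeltaXi_shift_add_one_ge n hr hdr hq k hk
          rw [h0, norm_zero] at this
          have := one_le_W n k hk; linarith
        rw [inv_sub_resolv hz hz1 N]
        exact norm_remainder_shift_le n hr hdr hq k hk N
    · rw [if_neg (fun h => hμν h.1), norm_zero]; exact cw_nonneg n N k
  · rw [if_neg (fun h => he h.2), if_neg he, norm_zero]

/-- the explicit `n`-UNIFORM majorant of the diagonal correction sum (needs `N + 1 ≥ d`). [folklore] -/
noncomputable def Mcorr (d N : ℕ) : ℝ := (N : ℝ) / (39 / 64) ^ N + (64 / 7) ^ (N + 1) * (2 * zetaC 2) ^ d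

/-- `0 ≤ Mcorr`. [folklore] -/
theorem Mcorr_nonneg (d N : ℕ) : 0 ≤ Mcorr d N := by
  have := zetaC_nonneg 2; unfold Mcorr; positivity

/-- `Σ_l cw_N(l) ≤ Mcorr d N` for `N + 1 ≥ d`, uniformly in `n`. [folklore] -/
theorem sum_cw_le {N : ℕ} (hN : d ≤ N + 1) : ∑ k : Fin d → Fin n, cw n N k ≤ Mcorr d N := by
  classical
  have hsplit : ∀ k : Fin d → Fin n, cw n N k
      ≤ (if k = fun _ => 0 then (N : ℝ) / (39 / 64) ^ N else 0)
        + (64 / 7) ^ (N + 1) * ∏ ν, (omega n (k ν) ^ 2)⁻¹ := by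
    intro k
    unfold cw
    split_ifs with hk
    · have : 0 ≤ (64 / 7 : ℝ) ^ (N + 1) * ∏ ν, (omega n (k ν) ^ 2)⁻¹ :=
        mul_nonneg (by positivity) (Finset.prod_nonneg (fun ν _ => inv_nonneg.mpr (sq_nonneg _)))
      linarith
    · rw [zero_add, div_eq_mul_one_div]
      exact mul_le_mul_of_nonneg_left (inv_W_pow_le_prod n k hk hN) (by positivity)
  calc ∑ k : Fin d → Fin n, cw n N k
      ≤ ∑ k : Fin d → Fin n, ((if k = fun _ => 0 then (N : ℝ) / (39 / 64) ^ N else 0)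
          + (64 / 7) ^ (N + 1) * ∏ ν, (omega n (k ν) ^ 2)⁻¹) := Finset.sum_le_sum (fun k _ => hsplit k)
    _ = (N : ℝ) / (39 / 64) ^ N + (64 / 7) ^ (N + 1) * ∑ k : Fin d → Fin n, ∏ ν, (omega n (k ν) ^ 2)⁻¹ := by
        rw [Finset.sum_add_distrib, Finset.sum_ite_eq' Finset.univ (fun _ : Fin d => (0 : Fin n)),
          if_pos (Finset.mem_univ _), ← Finset.mul_sum]
    _ ≤ Mcorr d N := by
        unfold Mcorr
        have := mul_le_mul_of_nonneg_left (sum_prod_inv_sq_le n (d := d)) (by positivity : (0 : ℝ) ≤ (64 / 7) ^ (N + 1))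
        linarith

/-- the double alias sum of the diagonal correction: `Σ_{l,l′}‖freeDiag − freeN‖ ≤ Mcorr d N`. [folklore] -/
theorem sum_norm_freeDiag_sub_freeN_le {κ : ℝ} (hκ0 : 0 ≤ κ) (hκ : κ ≤ kappa183 d) {p : Fin d → ℂ}
    (hp : p ∈ Strip d κ) {N : ℕ} (hN : d ≤ N + 1) (μ ν : Fin d) :
    ∑ k : Fin d → Fin n, ∑ k' : Fin d → Fin n, ‖freeDiag n μ ν k k' p - freeN n N μ ν k k' p‖ ≤ Mcorr d N := by
  classical
  calc ∑ k : Fin d → Fin n, ∑ k' : Fin d → Fin n, ‖freeDiag n μ ν k k' p - freeN n N μ ν k k' p‖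
      ≤ ∑ k : Fin d → Fin n, ∑ k' : Fin d → Fin n, (if k = k' then cw n N k else 0) :=
        Finset.sum_le_sum (fun k _ => Finset.sum_le_sum (fun k' _ =>
          norm_freeDiag_sub_freeN_le n hκ0 hκ hp N μ ν k k'))
    _ = ∑ k : Fin d → Fin n, cw n N k := by
        refine Finset.sum_congr rfl (fun k _ => ?_)
        rw [Finset.sum_ite_eq Finset.univ k, if_pos (Finset.mem_univ k)]
    _ ≤ Mcorr d N := sum_cw_le n hN

/-- the explicit `n`-UNIFORM majorant of the double alias sum of the covariant regular part. [folklore] -/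
noncomputable def Mcov183 (d N : ℕ) : ℝ := Mreg183 d + Mcorr d N

/-- `0 ≤ Mcov183`. [folklore] -/
theorem Mcov183_nonneg (d N : ℕ) : 0 ≤ Mcov183 d N :=
  add_nonneg (Mreg183_nonneg d) (Mcorr_nonneg d N)

/-- **THE `n`-UNIFORM DOUBLE ALIAS SUM OF THE COVARIANT REGULAR PART** of the continued (1.83) entry symbol:
for `N + 1 ≥ d`, every `n ≥ 1`, all `μ, ν` and every `p′` of the zero-free strip `Strip d κ`, `0 ≤ κ ≤ κ₁₈₃(d)`,
`Σ_{l,l′} ‖g_{μν}(l,l′;p′) − δ_{μν}δ_{ll′}R_N(Δ(p′+l))‖ ≤ Mcov183 d N`. [folklore] -/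
theorem sum_norm_g183cov_le {κ : ℝ} (hκ0 : 0 ≤ κ) (hκ : κ ≤ kappa183 d) {p : Fin d → ℂ} (hp : p ∈ Strip d κ)
    {N : ℕ} (hN : d ≤ N + 1) (μ ν : Fin d) :
    ∑ k : Fin d → Fin n, ∑ k' : Fin d → Fin n, ‖g183cov n N μ ν k k' p‖ ≤ Mcov183 d N := by
  have hreg := sum_norm_g183reg_le n hκ0 hκ hp μ ν
  have hcorr := sum_norm_freeDiag_sub_freeN_le n hκ0 hκ hp hN μ ν
  calc ∑ k : Fin d → Fin n, ∑ k' : Fin d → Fin n, ‖g183cov n N μ ν k k' p‖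
      ≤ ∑ k : Fin d → Fin n, ∑ k' : Fin d → Fin n,
          (‖g183reg n μ ν k k' p‖ + ‖freeDiag n μ ν k k' p - freeN n N μ ν k k' p‖) :=
        Finset.sum_le_sum (fun k _ => Finset.sum_le_sum (fun k' _ => by
          rw [g183cov_eq]; exact norm_add_le _ _))
    _ = (∑ k : Fin d → Fin n, ∑ k' : Fin d → Fin n, ‖g183reg n μ ν k k' p‖)
        + ∑ k : Fin d → Fin n, ∑ k' : Fin d → Fin n, ‖freeDiag n μ ν k k' p - freeN n N μ ν k k' p‖ := by
        rw [← Finset.sum_add_distrib]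
        exact Finset.sum_congr rfl (fun k _ => Finset.sum_add_distrib)
    _ ≤ Mcov183 d N := add_le_add hreg hcorr

/-- the free part is SMALL ENTRYWISE too: `‖freeN(l,l′)‖ ≤ δ_{μν}δ_{ll′}·N(64/39)^N` on the strip (crude, from
`‖Δ(p′+l)+1‖ ≥ 39/64` for all `l`), so `g^{cov,N}` inherits a per-entry bound uniform in `n, l, l′`. [folklore] -/
theorem norm_freeN_le {κ : ℝ} (hκ : κ ≤ kappa183 d) {p : Fin d → ℂ} (hp : p ∈ Strip d κ)
    (N : ℕ) (μ ν : Fin d) (k k' : Fin d → Fin n) :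
    ‖freeN n N μ ν k k' p‖ ≤ (N : ℝ) / (39 / 64) ^ N := by
  have hr := rOf_le d
  have hdr := d_mul_rOf_sq_le d
  have hq : p ∈ Fat d (rOf d) := strip_subset_fat (rOf_pos d).le (hκ.trans (kappa183_le_rOf d)) hp
  unfold freeN
  split_ifs with h
  · have h39 : (39 / 64 : ℝ) ≤ ‖DeltaXi n 0 (shift n k p) + 1‖ := by
      by_cases hk : k = fun _ => 0
      · rw [hk, shift_zero]; exact norm_DeltaXi0_add_one_ge n hr hdr hq
      · have h1 := norm_DeltaXi_shift_add_one_ge n hr hdr hq k hk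
        have h2 := one_le_W n k hk
        linarith
    exact norm_resolv_le (by norm_num) (by norm_num) h39 N
  · rw [norm_zero]; positivity

/-- per-entry bound of the covariant regular part, uniform in `n, l, l′`: `‖g^{cov,N}‖ ≤ M183 d + N(64/39)^N`.
[folklore] -/
theorem norm_g183cov_le {κ : ℝ} (hκ0 : 0 ≤ κ) (hκ : κ ≤ kappa183 d) {p : Fin d → ℂ} (hp : p ∈ Strip d κ)
    (N : ℕ) (μ ν : Fin d) (k k' : Fin d → Fin n) :
    ‖g183cov n N μ ν k k' p‖ ≤ M183 d + (N : ℝ) / (39 / 64) ^ N := by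
  unfold g183cov
  exact (norm_sub_le _ _).trans (add_le_add (norm_g183_le n hκ0 hκ hp μ ν k k') (norm_freeN_le n hκ hp N μ ν k k'))

end Sums

/-! ## §5. Holomorphy of the massive free diagonal and of the covariant regular part on the zero-free strip -/

section Holo

variable (n : ℕ) [NeZero n]

/-- `Δ(p′+l) + 1 ≠ 0` on the zero-free strip, for EVERY alias offset `l`. [folklore] -/
theorem DeltaXi_shift_add_one_ne_zero {κ : ℝ} (hκ : κ ≤ kappa183 d) {p : Fin d → ℂ} (hp : p ∈ Strip d κ)
    (k : Fin d → Fin n) : DeltaXi n 0 (shift n k p) + 1 ≠ 0 := by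
  have hr := rOf_le d
  have hdr := d_mul_rOf_sq_le d
  have hq : p ∈ Fat d (rOf d) := strip_subset_fat (rOf_pos d).le (hκ.trans (kappa183_le_rOf d)) hp
  have h39 : (39 / 64 : ℝ) ≤ ‖DeltaXi n 0 (shift n k p) + 1‖ := by
    by_cases hk : k = fun _ => 0
    · rw [hk, shift_zero]; exact norm_DeltaXi0_add_one_ge n hr hdr hq
    · have h1 := norm_DeltaXi_shift_add_one_ge n hr hdr hq k hk
      have h2 := one_le_W n k hk
      linarith
  intro h0; rw [h0, norm_zero] at h39; linarith

omit [NeZero n] in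
/-- `q ↦ R_N(f(q))` is holomorphic wherever `f` is and `f + 1 ≠ 0`. [folklore] -/
theorem differentiableAt_resolv_comp {f : (Fin d → ℂ) → ℂ} {p : Fin d → ℂ} (hf : DifferentiableAt ℂ f p)
    (h1 : f p + 1 ≠ 0) (N : ℕ) : DifferentiableAt ℂ (fun q => resolv N (f q)) p := by
  induction N with
  | zero =>
    simp only [resolv_zero]
    exact differentiableAt_const _
  | succ N ih =>
    have hfun : (fun q => resolv (N + 1) (f q)) = fun q => resolv N (f q) + 1 / (f q + 1) ^ (N + 1) := by
      funext q; rw [resolv_succ]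
    rw [hfun]
    have hpow : DifferentiableAt ℂ (fun q => (f q + 1) ^ (N + 1)) p := (hf.add_const 1).pow _
    exact ih.add (dAt_div (differentiableAt_const _) hpow (pow_ne_zero _ h1))

/-- the massive free diagonal `freeN` is holomorphic (jointly in `p′ ∈ ℂ^d`) at every point of the zero-free
strip, the origin included. [folklore] -/
theorem differentiableAt_freeN {κ : ℝ} (hκ : κ ≤ kappa183 d) {p : Fin d → ℂ} (hp : p ∈ Strip d κ)
    (N : ℕ) (μ ν : Fin d) (k k' : Fin d → Fin n) :
    DifferentiableAt ℂ (fun q : Fin d → ℂ => freeN n N μ ν k k' q) p := by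
  unfold freeN
  split_ifs with h
  · exact differentiableAt_resolv_comp (differentiableAt_DeltaXi_shift n 0 k p)
      (DeltaXi_shift_add_one_ne_zero n hκ hp k) N
  · exact differentiableAt_const _

/-- **HOLOMORPHY OF THE COVARIANT REGULAR PART** at every point of the zero-free strip `Strip d κ`,
`0 ≤ κ ≤ κ₁₈₃(d)` (from `B5G183Strip.differentiableAt_g183` and `differentiableAt_freeN`). [folklore] -/
theorem differentiableAt_g183cov {κ : ℝ} (hκ0 : 0 ≤ κ) (hκ : κ ≤ kappa183 d) {p : Fin d → ℂ}
    (hp : p ∈ Strip d κ) (N : ℕ) (μ ν : Fin d) (k k' : Fin d → Fin n) :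
    DifferentiableAt ℂ (fun q : Fin d → ℂ => g183cov n N μ ν k k' q) p := by
  unfold g183cov
  exact (differentiableAt_g183 n hκ0 hκ hp μ ν k k').sub (differentiableAt_freeN n hκ hp N μ ν k k')

end Holo

end Literature.MathematicalPhysics.QuantumFieldTheory.Balaban1983to89.B5G183CovSplit
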